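import Mathlib
import HarnessLib
import Summits.FinalStateConjecture.FinalStateConjecture.Theorems.LogTimeThreeAnnuliDyadicCaptureCaptureUpgradeC
import Summits.FinalStateConjecture.FinalStateConjecture.Theorems.LogTimeThreeAnnuliDyadicCaptureDefs
import Summits.FinalStateConjecture.FinalStateConjecture.Theorems.LogTimeThreeAnnuliDyadicCaptureReduction

/-!
# Route LogTimeThreeAnnuli · crux `DyadicCapture` — the reduction of the crux to `ERA → normalised ERA` (skeleton v6)

Lead c3 of the line `registered` (`Cruxes/DyadicCapture/Lines/birth.lean`). The v5 skeleton reduced the crux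
`Summit.FinalStateConjecture.FinalStateConjecture.Theses.LogTimeThreeAnnuli.DyadicCapture` (`ERA(𝒟) → CONCL(𝒟)`)
to ONE open stub, `stub_normalisedWindowwiseSummability` (a horizon-normalised honest era system with windowwise
dyadically SUMMABLE distance to the window family). This file shows that the summability is not needed:

* `captureUpgrade_hasFrozenConvergence` — over ANY spacetime, a reference chart system which is windowed-close
  (`HasWindowedCloseness`, the era's own last clause) and `C⁰`-normalised (each near zone converges in `C⁰` on
  every fixed slab to its OWN reference member) has its labels in the window and converges to them in every
  `Cᵏ` on fixed and growing slabs (`HasFrozenConvergence … d.mass d.spin`) — chart by chart `captureC_main`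
  (capture of the window parameters by anchor rigidity on the compact window, uniform slab jets, far-field decay).
* `frozenNormalised_of_normalisedEra` — hence the NEW open stub of the line,
  `stub_normalisedEra : ERA(𝒟) → ∃ system, ERA clauses verbatim ∧ C⁰ normalisation`, already yields the frozen,
  horizon-normalised honest era system that the landed rechart consumes, and
* `dyadicCapture_of_normalisedEra` — the written-out crux follows from `stub_normalisedEra`
  (`dyadicCapture_of_frozenNormalised`, p163672: `stub_relabelRechart` p158712 + `stub_settledRechart` p149044).
* `concl_of_normalisedEra_pointwise`, `concl_of_era_dispersal` — the pointwise form of the reduction (one development) and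
  its corollary: the crux holds outright for eras WITHOUT holes (`d.N = 0`, dispersal), the normalisation being vacuous.
* `normalisedEra_of_normalisedWindowwiseSummability` — MONOTONICITY of the reshape: the v5 stub implies the v6
  stub (windowwise summability ⟹ windowed closeness, `dyadicSelection_exists_late_window`), so v6's open
  statement is weaker than v5's and the line's summability mechanism remains one sufficient route to it.

Sources: Kerr–Schild 1965 §2 (the explicit stationary family); Dafermos–Luk arXiv:1710.01722, Conjecture 1 (b)–(c)
(asymptotic stability towards a nearby Kerr in horizon-normalised gauges); DHRT arXiv:2104.08222 §1 (the norms).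
-/

-- the `Summit.FinalStateConjecture.FinalStateConjecture.…` namespace repeats the summit = sub-problem
-- segment (D-0017 layout, CONVENTIONS §2); the duplicate is deliberate.
set_option linter.dupNamespace false

noncomputable section

namespace Summit.FinalStateConjecture.FinalStateConjecture.Theorems

open Literature.Geometry.Lorentzian
open scoped Topology Manifold ENNReal ContDiff
open Filter Set

-- the structure-update backgrounds of the registered signature unfold `d.background i` slowly
set_option synthInstance.maxHeartbeats 200000 in
set_option maxHeartbeats 3200000 in
/-- **Capture upgrade for a chart system** (registered helper `captureUpgrade_hasFrozenConvergence`): windowed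
closeness (`HasWindowedCloseness`) plus `C⁰` normalisation of every reference member on fixed slabs imply that the
reference labels lie in the window and `HasFrozenConvergence … d.mass d.spin` — chart by chart `captureC_main`
(`d.background i = boostedKerrBackground (d.motion i).1 (d.motion i).2 (d.mass i) (d.spin i)` by `rfl`). No
summability. [cite: KerrSchild1965, §2] -/
theorem captureUpgrade_hasFrozenConvergence : ∀ (𝓢 : Spacetime.{0} 4) (O : Set 𝓢.carrier) (d : QuasiFinalStateDecomposition 𝓢 O 2 ⊤) (R : Fin d.N → ℝ → ℝ) (m₀ χ : ℝ), 0 < m₀ → Summit.FinalStateConjecture.FinalStateConjecture.Theorems.HasWindowedCloseness 𝓢 O d R m₀ χ → (∀ (i : Fin d.N) (ρ : ℝ), Filter.Tendsto (fun τ => 𝓢.truncDeviationCk {d.background i with bilin := boostedKerrBilin (d.motion i).1 (d.motion i).2 (d.mass i) (d.spin i)} (d.chart i) 0 ρ τ) Filter.atTop (nhds 0)) → (∀ i : Fin d.N, m₀ ≤ d.mass i ∧ d.mass i ≤ m₀⁻¹ ∧ |d.spin i| ≤ χ * d.mass i) ∧ Summit.FinalStateConjecture.FinalStateConjecture.Theorems.HasFrozenConvergence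 𝓢 O d R d.mass d.spin := by
  intro 𝓢 O d R m₀ χ hm₀ hW hN
  have key : ∀ i : Fin d.N, (m₀ ≤ d.mass i ∧ d.mass i ≤ m₀⁻¹ ∧ |d.spin i| ≤ χ * d.mass i) ∧
      (∀ (k : ℕ) (ρ : ℝ), Filter.Tendsto (fun τ => 𝓢.truncDeviationCk {d.background i with
        bilin := boostedKerrBilin (d.motion i).1 (d.motion i).2 (d.mass i) (d.spin i)} (d.chart i) k ρ τ)
        Filter.atTop (nhds 0)) ∧
      (∀ k : ℕ, Filter.Tendsto (fun τ => 𝓢.truncDeviationCk {d.background i with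
        bilin := boostedKerrBilin (d.motion i).1 (d.motion i).2 (d.mass i) (d.spin i)} (d.chart i) k (R i τ) τ)
        Filter.atTop (nhds 0)) := by
    intro i
    have hWi := hW i
    have hNi := hN i
    unfold QuasiFinalStateDecomposition.background at hWi hNi ⊢
    exact captureC_main (d.motion i).1 (d.motion i).2 (d.mass i) (d.spin i) (d.chart i)
      (d.isLateChart i).contMDiff (d.mass_pos i) (R i) hm₀ hWi hNi
  exact ⟨fun i => (key i).1, fun i => (key i).2.1, fun i => (key i).2.2⟩

/-- **Stub N ⟹ a frozen, horizon-normalised honest era system.** From a `C⁰`-normalised honest era system (the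
conclusion of the v6 stub `stub_normalisedEra`: era clauses verbatim — in particular windowed closeness — and
`C⁰` convergence of each near zone to its own reference member on fixed slabs), `captureUpgrade_hasFrozenConvergence`
gives `HasFrozenConvergence … d.mass d.spin` and labels in the window, hence strictly sub-extremal labels
(`|a| ≤ χM < M`). Sorry-free. [cite: KerrSchild1965, §2] -/
theorem frozenNormalised_of_normalisedEra
    (h₁ : ∀ (X : Type) [TopologicalSpace X] [ChartedSpace E3 X] [IsManifold (𝓡 3) ((⊤ : ℕ∞) : WithTop ℕ∞) X] [T2Space X] [SecondCountableTopology X] [ConnectedSpace X], ∀ D ∈ admissibleVacuumData X, ∀ 𝒟 : VacuumCauchyDevelopment D, 𝒟.IsMaximal → Summit.FinalStateConjecture.HasCompleteNullInfinity 𝒟.toCauchyDevelopment → (∃ (m₀ χ : ℝ) (O : Set 𝒟.carrier) (d : QuasiFinalStateDecomposition 𝒟.toSpacetime O 2 ⊤) (R : Fin d.N → ℝ → ℝ), 0 < m₀ ∧ χ < 1 ∧ O = Summit.FinalStateConjecture.exteriorOf 𝒟.toCauchyDevelopment d.charted ∧ Summit.FinalStateConjecture.RaysStayInClosure 𝒟.toCauchyDevelopment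 O ∧ (∀ i : Fin d.N, Filter.Tendsto (R i) Filter.atTop Filter.atTop ∧ ∀ τ : ℝ, max (Kerr.rPlus (d.mass i) (d.spin i)) 0 + 1 ≤ R i τ) ∧ (∀ τ₁ : ℝ, d.τ₀ < τ₁ → O \ d.certifiedLate R τ₁ ⊆ 𝒟.metric.causalPast 𝒟.timeOrientation (d.certifiedSlab R τ₁)) ∧ (∀ i : Fin d.N, Summit.FinalStateConjecture.IsOrthochronous (d.motion i).1) ∧ (∀ (i : Fin d.N) (ρ : ℝ), ∀ᶠ τ in Filter.atTop, ∀ x ∈ (d.background i).truncTimeSlab ρ τ, ∀ w : E4, 𝒟.timeOrientation.IsFutureDirected (mfderiv 𝓘(ℝ, E4) (𝓡 4) (d.chart i) x w) → 0 < ((d.motion i).1 : E4 ≃L[ℝ] E4).symm w 0) ∧ (∀ᶠ τ in Filter.atTop, ∀ x ∈ (Minkowski.backgroundOn d.flatDomain).timeSlab τ, 𝒟.timeOrientation.IsFutureDirected (mfderiv 𝓘(ℝ, E4) (𝓡 4) d.flatChart x (E4.basisVector 0))) ∧ (∀ k : ℕ, Filter.Tendsto (fun τ => 𝒟.toSpacetime.deviationCk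 (Minkowski.backgroundOn d.flatDomain) d.flatChart k τ) Filter.atTop (nhds 0)) ∧ (∀ (i : Fin d.N) (k : ℕ) (ρ : ℝ) (ε : ENNReal), 0 < ε → ∀ᶠ τ in Filter.atTop, ∃ M a : ℝ, m₀ ≤ M ∧ M ≤ m₀⁻¹ ∧ |a| ≤ χ * M ∧ 𝒟.toSpacetime.truncDeviationCk {d.background i with bilin := boostedKerrBilin (d.motion i).1 (d.motion i).2 M a} (d.chart i) k ρ τ ≤ ε ∧ 𝒟.toSpacetime.truncDeviationCk {d.background i with bilin := boostedKerrBilin (d.motion i).1 (d.motion i).2 M a} (d.chart i) k (R i τ) τ ≤ ε)) → ∃ (m₀ χ : ℝ) (O : Set 𝒟.carrier) (d : QuasiFinalStateDecomposition 𝒟.toSpacetime O 2 ⊤) (R : Fin d.N → ℝ → ℝ), 0 < m₀ ∧ χ < 1 ∧ O = Summit.FinalStateConjecture.exteriorOf 𝒟.toCauchyDevelopment d.charted ∧ Summit.FinalStateConjecture.RaysStayInClosure 𝒟.toCauchyDevelopment O ∧ (∀ i : Fin d.N, Filter.Tendsto (R i) Filter.atTop Filter.atTop ∧ ∀ τ :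 ℝ, max (Kerr.rPlus (d.mass i) (d.spin i)) 0 + 1 ≤ R i τ) ∧ (∀ τ₁ : ℝ, d.τ₀ < τ₁ → O \ d.certifiedLate R τ₁ ⊆ 𝒟.metric.causalPast 𝒟.timeOrientation (d.certifiedSlab R τ₁)) ∧ (∀ i : Fin d.N, Summit.FinalStateConjecture.IsOrthochronous (d.motion i).1) ∧ (∀ (i : Fin d.N) (ρ : ℝ), ∀ᶠ τ in Filter.atTop, ∀ x ∈ (d.background i).truncTimeSlab ρ τ, ∀ w : E4, 𝒟.timeOrientation.IsFutureDirected (mfderiv 𝓘(ℝ, E4) (𝓡 4) (d.chart i) x w) → 0 < ((d.motion i).1 : E4 ≃L[ℝ] E4).symm w 0) ∧ (∀ᶠ τ in Filter.atTop, ∀ x ∈ (Minkowski.backgroundOn d.flatDomain).timeSlab τ, 𝒟.timeOrientation.IsFutureDirected (mfderiv 𝓘(ℝ, E4) (𝓡 4) d.flatChart x (E4.basisVector 0))) ∧ (∀ k : ℕ, Filter.Tendsto (fun τ => 𝒟.toSpacetime.deviationCk (Minkowski.backgroundOn d.flatDomain) d.flatChart k τ) Filter.atTop (nhds 0)) ∧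 (∀ (i : Fin d.N) (k : ℕ) (ρ : ℝ) (ε : ENNReal), 0 < ε → ∀ᶠ τ in Filter.atTop, ∃ M a : ℝ, m₀ ≤ M ∧ M ≤ m₀⁻¹ ∧ |a| ≤ χ * M ∧ 𝒟.toSpacetime.truncDeviationCk {d.background i with bilin := boostedKerrBilin (d.motion i).1 (d.motion i).2 M a} (d.chart i) k ρ τ ≤ ε ∧ 𝒟.toSpacetime.truncDeviationCk {d.background i with bilin := boostedKerrBilin (d.motion i).1 (d.motion i).2 M a} (d.chart i) k (R i τ) τ ≤ ε) ∧ (∀ (i : Fin d.N) (ρ : ℝ), Filter.Tendsto (fun τ => 𝒟.toSpacetime.truncDeviationCk {d.background i with bilin := boostedKerrBilin (d.motion i).1 (d.motion i).2 (d.mass i) (d.spin i)} (d.chart i) 0 ρ τ) Filter.atTop (nhds 0))) :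
    ∀ (X : Type) [TopologicalSpace X] [ChartedSpace E3 X] [IsManifold (𝓡 3) ((⊤ : ℕ∞) : WithTop ℕ∞) X] [T2Space X] [SecondCountableTopology X] [ConnectedSpace X], ∀ D ∈ admissibleVacuumData X, ∀ 𝒟 : VacuumCauchyDevelopment D, 𝒟.IsMaximal → Summit.FinalStateConjecture.HasCompleteNullInfinity 𝒟.toCauchyDevelopment → (∃ (m₀ χ : ℝ) (O : Set 𝒟.carrier) (d : QuasiFinalStateDecomposition 𝒟.toSpacetime O 2 ⊤) (R : Fin d.N → ℝ → ℝ), 0 < m₀ ∧ χ < 1 ∧ O = Summit.FinalStateConjecture.exteriorOf 𝒟.toCauchyDevelopment d.charted ∧ Summit.FinalStateConjecture.RaysStayInClosure 𝒟.toCauchyDevelopment O ∧ (∀ i : Fin d.N, Filter.Tendsto (R i) Filter.atTop Filter.atTop ∧ ∀ τ : ℝ, max (Kerr.rPlus (d.mass i) (d.spin i)) 0 + 1 ≤ R i τ) ∧ (∀ τ₁ : ℝ, d.τ₀ < τ₁ → O \ d.certifiedLate R τ₁ ⊆ 𝒟.metric.causalPast 𝒟.timeOrientation (d.certifiedSlab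 R τ₁)) ∧ (∀ i : Fin d.N, Summit.FinalStateConjecture.IsOrthochronous (d.motion i).1) ∧ (∀ (i : Fin d.N) (ρ : ℝ), ∀ᶠ τ in Filter.atTop, ∀ x ∈ (d.background i).truncTimeSlab ρ τ, ∀ w : E4, 𝒟.timeOrientation.IsFutureDirected (mfderiv 𝓘(ℝ, E4) (𝓡 4) (d.chart i) x w) → 0 < ((d.motion i).1 : E4 ≃L[ℝ] E4).symm w 0) ∧ (∀ᶠ τ in Filter.atTop, ∀ x ∈ (Minkowski.backgroundOn d.flatDomain).timeSlab τ, 𝒟.timeOrientation.IsFutureDirected (mfderiv 𝓘(ℝ, E4) (𝓡 4) d.flatChart x (E4.basisVector 0))) ∧ (∀ k : ℕ, Filter.Tendsto (fun τ => 𝒟.toSpacetime.deviationCk (Minkowski.backgroundOn d.flatDomain) d.flatChart k τ) Filter.atTop (nhds 0)) ∧ (∀ (i : Fin d.N) (k : ℕ) (ρ : ℝ) (ε : ENNReal), 0 < ε → ∀ᶠ τ in Filter.atTop, ∃ M a : ℝ, m₀ ≤ M ∧ M ≤ m₀⁻¹ ∧ |a| ≤ χ * M ∧ 𝒟.toSpacetime.truncDeviationCk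 {d.background i with bilin := boostedKerrBilin (d.motion i).1 (d.motion i).2 M a} (d.chart i) k ρ τ ≤ ε ∧ 𝒟.toSpacetime.truncDeviationCk {d.background i with bilin := boostedKerrBilin (d.motion i).1 (d.motion i).2 M a} (d.chart i) k (R i τ) τ ≤ ε)) → ∃ (O : Set 𝒟.carrier) (d : QuasiFinalStateDecomposition 𝒟.toSpacetime O 2 ⊤) (R : Fin d.N → ℝ → ℝ), Summit.FinalStateConjecture.FinalStateConjecture.Theorems.IsHonestEraSystem 𝒟 O d R ∧ (∀ i : Fin d.N, |d.spin i| < d.mass i) ∧ Summit.FinalStateConjecture.FinalStateConjecture.Theorems.HasFrozenConvergence 𝒟.toSpacetime O d R d.mass d.spin := by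
  intro X _ _ _ _ _ _ D hD 𝒟 hmax hI hera
  obtain ⟨m₀, χ, O, d, R, hm₀, hχ, hO, hrays, hR, hexh, horth, hcov, hflat0, hflat, hW, hN⟩ :=
    h₁ X D hD 𝒟 hmax hI hera
  obtain ⟨hwin, hfro⟩ := captureUpgrade_hasFrozenConvergence 𝒟.toSpacetime O d R m₀ χ hm₀ hW hN
  have hsub : ∀ i : Fin d.N, |d.spin i| < d.mass i := fun i =>
    (dyadicCaptureReduction_subextremal_of_window hm₀ hχ (hwin i).1 (hwin i).2.2).2
  exact ⟨O, d, R, ⟨hO, hrays, hR, hexh, horth, hcov, hflat0, hflat⟩, hsub, hfro⟩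

/-- **THE v6 REDUCTION.** The written-out crux `DyadicCapture` (`ERA(𝒟) → CONCL(𝒟)`, verbatim the body of
`Summit.FinalStateConjecture.FinalStateConjecture.Theses.LogTimeThreeAnnuli.DyadicCapture`) follows from the single open
stub `stub_normalisedEra` of skeleton v6: "an honest subconvergent final era can be re-gauged so that each near zone
converges in `C⁰`, on every fixed slab, to its own reference member". A closer proves the hypothesis in a module that
does not import the route file and concludes the crux by `exact dyadicCapture_of_normalisedEra h`. Sorry-free, axioms
`propext`, `Classical.choice`, `Quot.sound`. [cite: DafermosLuk2017, Conjecture 1 (b)–(c)] -/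
theorem dyadicCapture_of_normalisedEra
    (h₁ : ∀ (X : Type) [TopologicalSpace X] [ChartedSpace E3 X] [IsManifold (𝓡 3) ((⊤ : ℕ∞) : WithTop ℕ∞) X] [T2Space X] [SecondCountableTopology X] [ConnectedSpace X], ∀ D ∈ admissibleVacuumData X, ∀ 𝒟 : VacuumCauchyDevelopment D, 𝒟.IsMaximal → Summit.FinalStateConjecture.HasCompleteNullInfinity 𝒟.toCauchyDevelopment → (∃ (m₀ χ : ℝ) (O : Set 𝒟.carrier) (d : QuasiFinalStateDecomposition 𝒟.toSpacetime O 2 ⊤) (R : Fin d.N → ℝ → ℝ), 0 < m₀ ∧ χ < 1 ∧ O = Summit.FinalStateConjecture.exteriorOf 𝒟.toCauchyDevelopment d.charted ∧ Summit.FinalStateConjecture.RaysStayInClosure 𝒟.toCauchyDevelopment O ∧ (∀ i : Fin d.N, Filter.Tendsto (R i) Filter.atTop Filter.atTop ∧ ∀ τ : ℝ, max (Kerr.rPlus (d.mass i) (d.spin i)) 0 + 1 ≤ R i τ) ∧ (∀ τ₁ : ℝ, d.τ₀ < τ₁ → O \ d.certifiedLate R τ₁ ⊆ 𝒟.metric.causalPast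 𝒟.timeOrientation (d.certifiedSlab R τ₁)) ∧ (∀ i : Fin d.N, Summit.FinalStateConjecture.IsOrthochronous (d.motion i).1) ∧ (∀ (i : Fin d.N) (ρ : ℝ), ∀ᶠ τ in Filter.atTop, ∀ x ∈ (d.background i).truncTimeSlab ρ τ, ∀ w : E4, 𝒟.timeOrientation.IsFutureDirected (mfderiv 𝓘(ℝ, E4) (𝓡 4) (d.chart i) x w) → 0 < ((d.motion i).1 : E4 ≃L[ℝ] E4).symm w 0) ∧ (∀ᶠ τ in Filter.atTop, ∀ x ∈ (Minkowski.backgroundOn d.flatDomain).timeSlab τ, 𝒟.timeOrientation.IsFutureDirected (mfderiv 𝓘(ℝ, E4) (𝓡 4) d.flatChart x (E4.basisVector 0))) ∧ (∀ k : ℕ, Filter.Tendsto (fun τ => 𝒟.toSpacetime.deviationCk (Minkowski.backgroundOn d.flatDomain) d.flatChart k τ) Filter.atTop (nhds 0)) ∧ (∀ (i : Fin d.N) (k : ℕ) (ρ : ℝ) (ε : ENNReal), 0 < ε → ∀ᶠ τ in Filter.atTop, ∃ M a : ℝ, m₀ ≤ M ∧ M ≤ m₀⁻¹ ∧ |a|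 ≤ χ * M ∧ 𝒟.toSpacetime.truncDeviationCk {d.background i with bilin := boostedKerrBilin (d.motion i).1 (d.motion i).2 M a} (d.chart i) k ρ τ ≤ ε ∧ 𝒟.toSpacetime.truncDeviationCk {d.background i with bilin := boostedKerrBilin (d.motion i).1 (d.motion i).2 M a} (d.chart i) k (R i τ) τ ≤ ε)) → ∃ (m₀ χ : ℝ) (O : Set 𝒟.carrier) (d : QuasiFinalStateDecomposition 𝒟.toSpacetime O 2 ⊤) (R : Fin d.N → ℝ → ℝ), 0 < m₀ ∧ χ < 1 ∧ O = Summit.FinalStateConjecture.exteriorOf 𝒟.toCauchyDevelopment d.charted ∧ Summit.FinalStateConjecture.RaysStayInClosure 𝒟.toCauchyDevelopment O ∧ (∀ i : Fin d.N, Filter.Tendsto (R i) Filter.atTop Filter.atTop ∧ ∀ τ : ℝ, max (Kerr.rPlus (d.mass i) (d.spin i)) 0 + 1 ≤ R i τ) ∧ (∀ τ₁ : ℝ, d.τ₀ < τ₁ → O \ d.certifiedLate R τ₁ ⊆ 𝒟.metric.causalPast 𝒟.timeOrientation (d.certifiedSlab R τ₁)) ∧ (∀ i : Fin d.N, Summit.FinalStateConjecture.IsOrthochronous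 (d.motion i).1) ∧ (∀ (i : Fin d.N) (ρ : ℝ), ∀ᶠ τ in Filter.atTop, ∀ x ∈ (d.background i).truncTimeSlab ρ τ, ∀ w : E4, 𝒟.timeOrientation.IsFutureDirected (mfderiv 𝓘(ℝ, E4) (𝓡 4) (d.chart i) x w) → 0 < ((d.motion i).1 : E4 ≃L[ℝ] E4).symm w 0) ∧ (∀ᶠ τ in Filter.atTop, ∀ x ∈ (Minkowski.backgroundOn d.flatDomain).timeSlab τ, 𝒟.timeOrientation.IsFutureDirected (mfderiv 𝓘(ℝ, E4) (𝓡 4) d.flatChart x (E4.basisVector 0))) ∧ (∀ k : ℕ, Filter.Tendsto (fun τ => 𝒟.toSpacetime.deviationCk (Minkowski.backgroundOn d.flatDomain) d.flatChart k τ) Filter.atTop (nhds 0)) ∧ (∀ (i : Fin d.N) (k : ℕ) (ρ : ℝ) (ε : ENNReal), 0 < ε → ∀ᶠ τ in Filter.atTop, ∃ M a : ℝ, m₀ ≤ M ∧ M ≤ m₀⁻¹ ∧ |a| ≤ χ * M ∧ 𝒟.toSpacetime.truncDeviationCk {d.background i with bilin := boostedKerrBilin (d.motion i).1 (d.motion i).2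 M a} (d.chart i) k ρ τ ≤ ε ∧ 𝒟.toSpacetime.truncDeviationCk {d.background i with bilin := boostedKerrBilin (d.motion i).1 (d.motion i).2 M a} (d.chart i) k (R i τ) τ ≤ ε) ∧ (∀ (i : Fin d.N) (ρ : ℝ), Filter.Tendsto (fun τ => 𝒟.toSpacetime.truncDeviationCk {d.background i with bilin := boostedKerrBilin (d.motion i).1 (d.motion i).2 (d.mass i) (d.spin i)} (d.chart i) 0 ρ τ) Filter.atTop (nhds 0))) :
    ∀ (X : Type) [TopologicalSpace X] [ChartedSpace E3 X] [IsManifold (𝓡 3) ((⊤ : ℕ∞) : WithTop ℕ∞) X] [T2Space X] [SecondCountableTopology X] [ConnectedSpace X], ∀ D ∈ admissibleVacuumData X, ∀ 𝒟 : VacuumCauchyDevelopment D, 𝒟.IsMaximal → Summit.FinalStateConjecture.HasCompleteNullInfinity 𝒟.toCauchyDevelopment → (∃ (m₀ χ : ℝ) (O : Set 𝒟.carrier) (d : QuasiFinalStateDecomposition 𝒟.toSpacetime O 2 ⊤) (R : Fin d.N → ℝ → ℝ), 0 < m₀ ∧ χ < 1 ∧ O = Summit.FinalStateConjecture.exteriorOf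 𝒟.toCauchyDevelopment d.charted ∧ Summit.FinalStateConjecture.RaysStayInClosure 𝒟.toCauchyDevelopment O ∧ (∀ i : Fin d.N, Filter.Tendsto (R i) Filter.atTop Filter.atTop ∧ ∀ τ : ℝ, max (Kerr.rPlus (d.mass i) (d.spin i)) 0 + 1 ≤ R i τ) ∧ (∀ τ₁ : ℝ, d.τ₀ < τ₁ → O \ d.certifiedLate R τ₁ ⊆ 𝒟.metric.causalPast 𝒟.timeOrientation (d.certifiedSlab R τ₁)) ∧ (∀ i : Fin d.N, Summit.FinalStateConjecture.IsOrthochronous (d.motion i).1) ∧ (∀ (i : Fin d.N) (ρ : ℝ), ∀ᶠ τ in Filter.atTop, ∀ x ∈ (d.background i).truncTimeSlab ρ τ, ∀ w : E4, 𝒟.timeOrientation.IsFutureDirected (mfderiv 𝓘(ℝ, E4) (𝓡 4) (d.chart i) x w) → 0 < ((d.motion i).1 : E4 ≃L[ℝ] E4).symm w 0) ∧ (∀ᶠ τ in Filter.atTop, ∀ x ∈ (Minkowski.backgroundOn d.flatDomain).timeSlab τ, 𝒟.timeOrientation.IsFutureDirected (mfderiv 𝓘(ℝ, E4) (𝓡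 4) d.flatChart x (E4.basisVector 0))) ∧ (∀ k : ℕ, Filter.Tendsto (fun τ => 𝒟.toSpacetime.deviationCk (Minkowski.backgroundOn d.flatDomain) d.flatChart k τ) Filter.atTop (nhds 0)) ∧ (∀ (i : Fin d.N) (k : ℕ) (ρ : ℝ) (ε : ENNReal), 0 < ε → ∀ᶠ τ in Filter.atTop, ∃ M a : ℝ, m₀ ≤ M ∧ M ≤ m₀⁻¹ ∧ |a| ≤ χ * M ∧ 𝒟.toSpacetime.truncDeviationCk {d.background i with bilin := boostedKerrBilin (d.motion i).1 (d.motion i).2 M a} (d.chart i) k ρ τ ≤ ε ∧ 𝒟.toSpacetime.truncDeviationCk {d.background i with bilin := boostedKerrBilin (d.motion i).1 (d.motion i).2 M a} (d.chart i) k (R i τ) τ ≤ ε)) → (∃ (O' : Set 𝒟.carrier) (d' : FinalStateDecomposition 𝒟.toSpacetime O' 2), (∀ i, Kerr.IsSubextremal (d'.mass i) (d'.spin i)) ∧ O' = Summit.FinalStateConjecture.exteriorOf 𝒟.toCauchyDevelopment d'.charted ∧ Summit.FinalStateConjecture.RaysStayInClosure 𝒟.toCauchyDevelopment O' ∧ Summit.FinalStateConjecture.HasExhaustiveCharts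 d' ∧ Summit.FinalStateConjecture.IsFutureOriented d') :=
  dyadicCapture_of_frozenNormalised (frozenNormalised_of_normalisedEra h₁)

-- the structure-update backgrounds of the registered signatures unfold slowly
set_option synthInstance.maxHeartbeats 200000 in
set_option maxHeartbeats 3200000 in
/-- **Monotonicity of the reshape v5 → v6**: the v5 stub `stub_normalisedWindowwiseSummability` implies the v6 stub
`stub_normalisedEra` — the same system serves; windowed closeness follows from windowwise summability (a summable
series of window errors tends to `0`, `ENNReal.tendsto_atTop_zero_of_tsum_ne_top`; every late time lies in a late
dyadic window, `dyadicSelection_exists_late_window`; the infimum over the window is attained up to `ε`). [cite: Simon1983, §0] -/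
theorem normalisedEra_of_normalisedWindowwiseSummability
    (h : ∀ (X : Type) [TopologicalSpace X] [ChartedSpace E3 X] [IsManifold (𝓡 3) ((⊤ : ℕ∞) : WithTop ℕ∞) X] [T2Space X] [SecondCountableTopology X] [ConnectedSpace X], ∀ D ∈ admissibleVacuumData X, ∀ 𝒟 : VacuumCauchyDevelopment D, 𝒟.IsMaximal → Summit.FinalStateConjecture.HasCompleteNullInfinity 𝒟.toCauchyDevelopment → (∃ (m₀ χ : ℝ) (O : Set 𝒟.carrier) (d : QuasiFinalStateDecomposition 𝒟.toSpacetime O 2 ⊤) (R : Fin d.N → ℝ → ℝ), 0 < m₀ ∧ χ < 1 ∧ O = Summit.FinalStateConjecture.exteriorOf 𝒟.toCauchyDevelopment d.charted ∧ Summit.FinalStateConjecture.RaysStayInClosure 𝒟.toCauchyDevelopment O ∧ (∀ i : Fin d.N, Filter.Tendsto (R i) Filter.atTop Filter.atTop ∧ ∀ τ : ℝ, max (Kerr.rPlus (d.mass i) (d.spin i)) 0 + 1 ≤ R i τ) ∧ (∀ τ₁ : ℝ, d.τ₀ < τ₁ → O \ d.certifiedLate R τ₁ ⊆ 𝒟.metric.causalPast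 𝒟.timeOrientation (d.certifiedSlab R τ₁)) ∧ (∀ i : Fin d.N, Summit.FinalStateConjecture.IsOrthochronous (d.motion i).1) ∧ (∀ (i : Fin d.N) (ρ : ℝ), ∀ᶠ τ in Filter.atTop, ∀ x ∈ (d.background i).truncTimeSlab ρ τ, ∀ w : E4, 𝒟.timeOrientation.IsFutureDirected (mfderiv 𝓘(ℝ, E4) (𝓡 4) (d.chart i) x w) → 0 < ((d.motion i).1 : E4 ≃L[ℝ] E4).symm w 0) ∧ (∀ᶠ τ in Filter.atTop, ∀ x ∈ (Minkowski.backgroundOn d.flatDomain).timeSlab τ, 𝒟.timeOrientation.IsFutureDirected (mfderiv 𝓘(ℝ, E4) (𝓡 4) d.flatChart x (E4.basisVector 0))) ∧ (∀ k : ℕ, Filter.Tendsto (fun τ => 𝒟.toSpacetime.deviationCk (Minkowski.backgroundOn d.flatDomain) d.flatChart k τ) Filter.atTop (nhds 0)) ∧ (∀ (i : Fin d.N) (k : ℕ) (ρ : ℝ) (ε : ENNReal), 0 < ε → ∀ᶠ τ in Filter.atTop, ∃ M a : ℝ, m₀ ≤ M ∧ M ≤ m₀⁻¹ ∧ |a|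 ≤ χ * M ∧ 𝒟.toSpacetime.truncDeviationCk {d.background i with bilin := boostedKerrBilin (d.motion i).1 (d.motion i).2 M a} (d.chart i) k ρ τ ≤ ε ∧ 𝒟.toSpacetime.truncDeviationCk {d.background i with bilin := boostedKerrBilin (d.motion i).1 (d.motion i).2 M a} (d.chart i) k (R i τ) τ ≤ ε)) → ∃ (m₀ χ : ℝ) (O : Set 𝒟.carrier) (d : QuasiFinalStateDecomposition 𝒟.toSpacetime O 2 ⊤) (R : Fin d.N → ℝ → ℝ), 0 < m₀ ∧ χ < 1 ∧ O = Summit.FinalStateConjecture.exteriorOf 𝒟.toCauchyDevelopment d.charted ∧ Summit.FinalStateConjecture.RaysStayInClosure 𝒟.toCauchyDevelopment O ∧ (∀ i : Fin d.N, Filter.Tendsto (R i) Filter.atTop Filter.atTop ∧ ∀ τ : ℝ, max (Kerr.rPlus (d.mass i) (d.spin i)) 0 + 1 ≤ R i τ) ∧ (∀ τ₁ : ℝ, d.τ₀ < τ₁ → O \ d.certifiedLate R τ₁ ⊆ 𝒟.metric.causalPast 𝒟.timeOrientation (d.certifiedSlab R τ₁)) ∧ (∀ i : Fin d.N, Summit.FinalStateConjecture.IsOrthochronous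 (d.motion i).1) ∧ (∀ (i : Fin d.N) (ρ : ℝ), ∀ᶠ τ in Filter.atTop, ∀ x ∈ (d.background i).truncTimeSlab ρ τ, ∀ w : E4, 𝒟.timeOrientation.IsFutureDirected (mfderiv 𝓘(ℝ, E4) (𝓡 4) (d.chart i) x w) → 0 < ((d.motion i).1 : E4 ≃L[ℝ] E4).symm w 0) ∧ (∀ᶠ τ in Filter.atTop, ∀ x ∈ (Minkowski.backgroundOn d.flatDomain).timeSlab τ, 𝒟.timeOrientation.IsFutureDirected (mfderiv 𝓘(ℝ, E4) (𝓡 4) d.flatChart x (E4.basisVector 0))) ∧ (∀ k : ℕ, Filter.Tendsto (fun τ => 𝒟.toSpacetime.deviationCk (Minkowski.backgroundOn d.flatDomain) d.flatChart k τ) Filter.atTop (nhds 0)) ∧ (∀ (i : Fin d.N) (k : ℕ) (ρ : ℝ), ∃ n₀ : ℕ, (∑' n : ℕ, ⨅ (M : ℝ) (a : ℝ) (_ : m₀ ≤ M ∧ M ≤ m₀⁻¹ ∧ |a| ≤ χ * M), ⨆ τ ∈ Set.Icc ((2 : ℝ) ^ (n₀ + n)) ((2 : ℝ) ^ (n₀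 + n + 1)), (𝒟.toSpacetime.truncDeviationCk {d.background i with bilin := boostedKerrBilin (d.motion i).1 (d.motion i).2 M a} (d.chart i) k ρ τ + 𝒟.toSpacetime.truncDeviationCk {d.background i with bilin := boostedKerrBilin (d.motion i).1 (d.motion i).2 M a} (d.chart i) k (R i τ) τ)) ≠ ⊤) ∧ (∀ (i : Fin d.N) (ρ : ℝ), Filter.Tendsto (fun τ => 𝒟.toSpacetime.truncDeviationCk {d.background i with bilin := boostedKerrBilin (d.motion i).1 (d.motion i).2 (d.mass i) (d.spin i)} (d.chart i) 0 ρ τ) Filter.atTop (nhds 0))) :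
    ∀ (X : Type) [TopologicalSpace X] [ChartedSpace E3 X] [IsManifold (𝓡 3) ((⊤ : ℕ∞) : WithTop ℕ∞) X] [T2Space X] [SecondCountableTopology X] [ConnectedSpace X], ∀ D ∈ admissibleVacuumData X, ∀ 𝒟 : VacuumCauchyDevelopment D, 𝒟.IsMaximal → Summit.FinalStateConjecture.HasCompleteNullInfinity 𝒟.toCauchyDevelopment → (∃ (m₀ χ : ℝ) (O : Set 𝒟.carrier) (d : QuasiFinalStateDecomposition 𝒟.toSpacetime O 2 ⊤) (R : Fin d.N → ℝ → ℝ), 0 < m₀ ∧ χ < 1 ∧ O = Summit.FinalStateConjecture.exteriorOf 𝒟.toCauchyDevelopment d.charted ∧ Summit.FinalStateConjecture.RaysStayInClosure 𝒟.toCauchyDevelopment O ∧ (∀ i : Fin d.N, Filter.Tendsto (R i) Filter.atTop Filter.atTop ∧ ∀ τ : ℝ, max (Kerr.rPlus (d.mass i) (d.spin i)) 0 + 1 ≤ R i τ) ∧ (∀ τ₁ : ℝ, d.τ₀ < τ₁ → O \ d.certifiedLate R τ₁ ⊆ 𝒟.metric.causalPast 𝒟.timeOrientation (d.certifiedSlab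 R τ₁)) ∧ (∀ i : Fin d.N, Summit.FinalStateConjecture.IsOrthochronous (d.motion i).1) ∧ (∀ (i : Fin d.N) (ρ : ℝ), ∀ᶠ τ in Filter.atTop, ∀ x ∈ (d.background i).truncTimeSlab ρ τ, ∀ w : E4, 𝒟.timeOrientation.IsFutureDirected (mfderiv 𝓘(ℝ, E4) (𝓡 4) (d.chart i) x w) → 0 < ((d.motion i).1 : E4 ≃L[ℝ] E4).symm w 0) ∧ (∀ᶠ τ in Filter.atTop, ∀ x ∈ (Minkowski.backgroundOn d.flatDomain).timeSlab τ, 𝒟.timeOrientation.IsFutureDirected (mfderiv 𝓘(ℝ, E4) (𝓡 4) d.flatChart x (E4.basisVector 0))) ∧ (∀ k : ℕ, Filter.Tendsto (fun τ => 𝒟.toSpacetime.deviationCk (Minkowski.backgroundOn d.flatDomain) d.flatChart k τ) Filter.atTop (nhds 0)) ∧ (∀ (i : Fin d.N) (k : ℕ) (ρ : ℝ) (ε : ENNReal), 0 < ε → ∀ᶠ τ in Filter.atTop, ∃ M a : ℝ, m₀ ≤ M ∧ M ≤ m₀⁻¹ ∧ |a| ≤ χ * M ∧ 𝒟.toSpacetime.truncDeviationCk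 {d.background i with bilin := boostedKerrBilin (d.motion i).1 (d.motion i).2 M a} (d.chart i) k ρ τ ≤ ε ∧ 𝒟.toSpacetime.truncDeviationCk {d.background i with bilin := boostedKerrBilin (d.motion i).1 (d.motion i).2 M a} (d.chart i) k (R i τ) τ ≤ ε)) → ∃ (m₀ χ : ℝ) (O : Set 𝒟.carrier) (d : QuasiFinalStateDecomposition 𝒟.toSpacetime O 2 ⊤) (R : Fin d.N → ℝ → ℝ), 0 < m₀ ∧ χ < 1 ∧ O = Summit.FinalStateConjecture.exteriorOf 𝒟.toCauchyDevelopment d.charted ∧ Summit.FinalStateConjecture.RaysStayInClosure 𝒟.toCauchyDevelopment O ∧ (∀ i : Fin d.N, Filter.Tendsto (R i) Filter.atTop Filter.atTop ∧ ∀ τ : ℝ, max (Kerr.rPlus (d.mass i) (d.spin i)) 0 + 1 ≤ R i τ) ∧ (∀ τ₁ : ℝ, d.τ₀ < τ₁ → O \ d.certifiedLate R τ₁ ⊆ 𝒟.metric.causalPast 𝒟.timeOrientation (d.certifiedSlab R τ₁)) ∧ (∀ i : Fin d.N, Summit.FinalStateConjecture.IsOrthochronous (d.motion i).1) ∧ (∀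 (i : Fin d.N) (ρ : ℝ), ∀ᶠ τ in Filter.atTop, ∀ x ∈ (d.background i).truncTimeSlab ρ τ, ∀ w : E4, 𝒟.timeOrientation.IsFutureDirected (mfderiv 𝓘(ℝ, E4) (𝓡 4) (d.chart i) x w) → 0 < ((d.motion i).1 : E4 ≃L[ℝ] E4).symm w 0) ∧ (∀ᶠ τ in Filter.atTop, ∀ x ∈ (Minkowski.backgroundOn d.flatDomain).timeSlab τ, 𝒟.timeOrientation.IsFutureDirected (mfderiv 𝓘(ℝ, E4) (𝓡 4) d.flatChart x (E4.basisVector 0))) ∧ (∀ k : ℕ, Filter.Tendsto (fun τ => 𝒟.toSpacetime.deviationCk (Minkowski.backgroundOn d.flatDomain) d.flatChart k τ) Filter.atTop (nhds 0)) ∧ (∀ (i : Fin d.N) (k : ℕ) (ρ : ℝ) (ε : ENNReal), 0 < ε → ∀ᶠ τ in Filter.atTop, ∃ M a : ℝ, m₀ ≤ M ∧ M ≤ m₀⁻¹ ∧ |a| ≤ χ * M ∧ 𝒟.toSpacetime.truncDeviationCk {d.background i with bilin := boostedKerrBilin (d.motion i).1 (d.motion i).2 M a} (d.chart i) k ρ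 τ ≤ ε ∧ 𝒟.toSpacetime.truncDeviationCk {d.background i with bilin := boostedKerrBilin (d.motion i).1 (d.motion i).2 M a} (d.chart i) k (R i τ) τ ≤ ε) ∧ (∀ (i : Fin d.N) (ρ : ℝ), Filter.Tendsto (fun τ => 𝒟.toSpacetime.truncDeviationCk {d.background i with bilin := boostedKerrBilin (d.motion i).1 (d.motion i).2 (d.mass i) (d.spin i)} (d.chart i) 0 ρ τ) Filter.atTop (nhds 0)) := by
  intro X _ _ _ _ _ _ D hD 𝒟 hmax hI hera
  obtain ⟨m₀, χ, O, d, R, hm₀, hχ, hO, hrays, hR, hexh, horth, hcov, hflat0, hflat, hS, hN⟩ :=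
    h X D hD 𝒟 hmax hI hera
  refine ⟨m₀, χ, O, d, R, hm₀, hχ, hO, hrays, hR, hexh, horth, hcov, hflat0, hflat, ?_, hN⟩
  intro i k ρ ε hε
  obtain ⟨n₀, hsum⟩ := hS i k ρ
  have htend := ENNReal.tendsto_atTop_zero_of_tsum_ne_top hsum
  have hev : ∀ᶠ n : ℕ in Filter.atTop, (⨅ (M : ℝ) (a : ℝ) (_ : m₀ ≤ M ∧ M ≤ m₀⁻¹ ∧ |a| ≤ χ * M),
      ⨆ τ ∈ Set.Icc ((2 : ℝ) ^ (n₀ + n)) ((2 : ℝ) ^ (n₀ + n + 1)),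
        (𝒟.toSpacetime.truncDeviationCk {d.background i with
            bilin := boostedKerrBilin (d.motion i).1 (d.motion i).2 M a} (d.chart i) k ρ τ +
          𝒟.toSpacetime.truncDeviationCk {d.background i with
            bilin := boostedKerrBilin (d.motion i).1 (d.motion i).2 M a} (d.chart i) k (R i τ) τ)) < ε :=
    htend (Iio_mem_nhds hε)
  obtain ⟨N, hNev⟩ := Filter.eventually_atTop.1 hev
  refine Filter.eventually_atTop.2 ⟨(2 : ℝ) ^ (n₀ + N), fun τ hτ => ?_⟩
  obtain ⟨n, hn, hτn⟩ := dyadicSelection_exists_late_window n₀ N τ hτ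
  have hlt := hNev n hn
  obtain ⟨M, hM⟩ := iInf_lt_iff.1 hlt
  obtain ⟨a, ha⟩ := iInf_lt_iff.1 hM
  obtain ⟨hw, hlt'⟩ := iInf_lt_iff.1 ha
  have hle : 𝒟.toSpacetime.truncDeviationCk {d.background i with
        bilin := boostedKerrBilin (d.motion i).1 (d.motion i).2 M a} (d.chart i) k ρ τ +
      𝒟.toSpacetime.truncDeviationCk {d.background i with
        bilin := boostedKerrBilin (d.motion i).1 (d.motion i).2 M a} (d.chart i) k (R i τ) τ ≤ ε :=
    (le_iSup₂_of_le (f := fun τ' (_ : τ' ∈ Set.Icc ((2 : ℝ) ^ (n₀ + n)) ((2 : ℝ) ^ (n₀ + n + 1))) =>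
      𝒟.toSpacetime.truncDeviationCk {d.background i with
          bilin := boostedKerrBilin (d.motion i).1 (d.motion i).2 M a} (d.chart i) k ρ τ' +
        𝒟.toSpacetime.truncDeviationCk {d.background i with
          bilin := boostedKerrBilin (d.motion i).1 (d.motion i).2 M a} (d.chart i) k (R i τ') τ') τ hτn le_rfl).trans
      hlt'.le
  exact ⟨M, a, hw.1, hw.2.1, hw.2.2, le_self_add.trans hle, le_add_self.trans hle⟩

-- the structure-update backgrounds of the signature unfold slowly
set_option synthInstance.maxHeartbeats 200000 in
set_option maxHeartbeats 3200000 in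
/-- **Pointwise form of the v6 reduction**: for ONE maximal development with complete `𝓘⁺`, a `C⁰`-normalised honest era
system (era clauses verbatim + `C⁰` convergence of each near zone to its own reference member on fixed slabs) settles as the
re-typed Statement demands — capture upgrade, sub-extremality from the window, then the landed rechart
(`stub_relabelRechart` p158712 with labels matching, `stub_settledRechart` p149044). [cite: DafermosLuk2017, Conjecture 1 (b)–(c)] -/
theorem concl_of_normalisedEra_pointwise :
    ∀ (X : Type) [TopologicalSpace X] [ChartedSpace E3 X] [IsManifold (𝓡 3) ((⊤ : ℕ∞) : WithTop ℕ∞) X] [T2Space X] [SecondCountableTopology X] [ConnectedSpace X], ∀ D ∈ admissibleVacuumData X, ∀ 𝒟 : VacuumCauchyDevelopment D, 𝒟.IsMaximal → Summit.FinalStateConjecture.HasCompleteNullInfinity 𝒟.toCauchyDevelopment → (∃ (m₀ χ : ℝ) (O : Set 𝒟.carrier) (d : QuasiFinalStateDecomposition 𝒟.toSpacetime O 2 ⊤) (R : Fin d.N → ℝ → ℝ), 0 < m₀ ∧ χ < 1 ∧ O = Summit.FinalStateConjecture.exteriorOf 𝒟.toCauchyDevelopment d.charted ∧ Summit.FinalStateConjecture.RaysStayInClosure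 𝒟.toCauchyDevelopment O ∧ (∀ i : Fin d.N, Filter.Tendsto (R i) Filter.atTop Filter.atTop ∧ ∀ τ : ℝ, max (Kerr.rPlus (d.mass i) (d.spin i)) 0 + 1 ≤ R i τ) ∧ (∀ τ₁ : ℝ, d.τ₀ < τ₁ → O \ d.certifiedLate R τ₁ ⊆ 𝒟.metric.causalPast 𝒟.timeOrientation (d.certifiedSlab R τ₁)) ∧ (∀ i : Fin d.N, Summit.FinalStateConjecture.IsOrthochronous (d.motion i).1) ∧ (∀ (i : Fin d.N) (ρ : ℝ), ∀ᶠ τ in Filter.atTop, ∀ x ∈ (d.background i).truncTimeSlab ρ τ, ∀ w : E4, 𝒟.timeOrientation.IsFutureDirected (mfderiv 𝓘(ℝ, E4) (𝓡 4) (d.chart i) x w) → 0 < ((d.motion i).1 : E4 ≃L[ℝ] E4).symm w 0) ∧ (∀ᶠ τ in Filter.atTop, ∀ x ∈ (Minkowski.backgroundOn d.flatDomain).timeSlab τ, 𝒟.timeOrientation.IsFutureDirected (mfderiv 𝓘(ℝ, E4) (𝓡 4) d.flatChart x (E4.basisVector 0))) ∧ (∀ k : ℕ, Filter.Tendsto (fun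 τ => 𝒟.toSpacetime.deviationCk (Minkowski.backgroundOn d.flatDomain) d.flatChart k τ) Filter.atTop (nhds 0)) ∧ (∀ (i : Fin d.N) (k : ℕ) (ρ : ℝ) (ε : ENNReal), 0 < ε → ∀ᶠ τ in Filter.atTop, ∃ M a : ℝ, m₀ ≤ M ∧ M ≤ m₀⁻¹ ∧ |a| ≤ χ * M ∧ 𝒟.toSpacetime.truncDeviationCk {d.background i with bilin := boostedKerrBilin (d.motion i).1 (d.motion i).2 M a} (d.chart i) k ρ τ ≤ ε ∧ 𝒟.toSpacetime.truncDeviationCk {d.background i with bilin := boostedKerrBilin (d.motion i).1 (d.motion i).2 M a} (d.chart i) k (R i τ) τ ≤ ε) ∧ (∀ (i : Fin d.N) (ρ : ℝ), Filter.Tendsto (fun τ => 𝒟.toSpacetime.truncDeviationCk {d.background i with bilin := boostedKerrBilin (d.motion i).1 (d.motion i).2 (d.mass i) (d.spin i)} (d.chart i) 0 ρ τ) Filter.atTop (nhds 0))) → (∃ (O' : Set 𝒟.carrier) (d' : FinalStateDecomposition 𝒟.toSpacetime O' 2), (∀ i, Kerr.IsSubextremal (d'.mass i) (d'.spin i)) ∧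 O' = Summit.FinalStateConjecture.exteriorOf 𝒟.toCauchyDevelopment d'.charted ∧ Summit.FinalStateConjecture.RaysStayInClosure 𝒟.toCauchyDevelopment O' ∧ Summit.FinalStateConjecture.HasExhaustiveCharts d' ∧ Summit.FinalStateConjecture.IsFutureOriented d') := by
  intro X _ _ _ _ _ _ D hD 𝒟 hmax hI hsys
  obtain ⟨m₀, χ, O, d, R, hm₀, hχ, hO, hrays, hR, hexh, horth, hcov, hflat0, hflat, hW, hN⟩ := hsys
  obtain ⟨hwin, hfro⟩ := captureUpgrade_hasFrozenConvergence 𝒟.toSpacetime O d R m₀ χ hm₀ hW hN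
  have hsub : ∀ i : Fin d.N, 0 < d.mass i ∧ |d.spin i| < d.mass i := fun i =>
    ⟨d.mass_pos i, (dyadicCaptureReduction_subextremal_of_window hm₀ hχ (hwin i).1 (hwin i).2.2).2⟩
  obtain ⟨O', d', h1, h2, h3, h4, h5, h6, h7⟩ :=
    stub_relabelRechart X D hD 𝒟 hmax hI O d R d.mass d.spin ⟨hO, hrays, hR, hexh, horth, hcov, hflat0, hflat⟩ hsub hfro
      fun i => ⟨rfl, rfl⟩
  exact stub_settledRechart X D hD 𝒟 hmax hI O' d' h1 h2 h3 h4 h5 h6 h7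

-- the structure-update backgrounds of the signature unfold slowly
set_option synthInstance.maxHeartbeats 200000 in
set_option maxHeartbeats 3200000 in
/-- **The dispersal regime of the crux is a theorem**: an honest subconvergent final era WITHOUT holes (`d.N = 0`: the flat
chart alone certifies `O`) settles as the Statement demands — the `C⁰` normalisation clause is vacuous, so
`concl_of_normalisedEra_pointwise` applies to the era's own system. (The crux `DyadicCapture` is thus open only through its
`N ≥ 1` instances.) [cite: DafermosLuk2017, Conjecture 1 (b)–(c)] -/
theorem concl_of_era_dispersal :
    ∀ (X : Type) [TopologicalSpace X] [ChartedSpace E3 X] [IsManifold (𝓡 3) ((⊤ : ℕ∞) : WithTop ℕ∞) X] [T2Space X] [SecondCountableTopology X] [ConnectedSpace X], ∀ D ∈ admissibleVacuumData X, ∀ 𝒟 : VacuumCauchyDevelopment D, 𝒟.IsMaximal → Summit.FinalStateConjecture.HasCompleteNullInfinity 𝒟.toCauchyDevelopment → (∃ (m₀ χ : ℝ) (O : Set 𝒟.carrier) (d : QuasiFinalStateDecomposition 𝒟.toSpacetime O 2 ⊤) (R : Fin d.N → ℝ → ℝ), d.N = 0 ∧ 0 < m₀ ∧ χ < 1 ∧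 O = Summit.FinalStateConjecture.exteriorOf 𝒟.toCauchyDevelopment d.charted ∧ Summit.FinalStateConjecture.RaysStayInClosure 𝒟.toCauchyDevelopment O ∧ (∀ i : Fin d.N, Filter.Tendsto (R i) Filter.atTop Filter.atTop ∧ ∀ τ : ℝ, max (Kerr.rPlus (d.mass i) (d.spin i)) 0 + 1 ≤ R i τ) ∧ (∀ τ₁ : ℝ, d.τ₀ < τ₁ → O \ d.certifiedLate R τ₁ ⊆ 𝒟.metric.causalPast 𝒟.timeOrientation (d.certifiedSlab R τ₁)) ∧ (∀ i : Fin d.N, Summit.FinalStateConjecture.IsOrthochronous (d.motion i).1) ∧ (∀ (i : Fin d.N) (ρ : ℝ), ∀ᶠ τ in Filter.atTop, ∀ x ∈ (d.background i).truncTimeSlab ρ τ, ∀ w : E4, 𝒟.timeOrientation.IsFutureDirected (mfderiv 𝓘(ℝ, E4) (𝓡 4) (d.chart i) x w) → 0 < ((d.motion i).1 : E4 ≃L[ℝ] E4).symm w 0) ∧ (∀ᶠ τ in Filter.atTop, ∀ x ∈ (Minkowski.backgroundOn d.flatDomain).timeSlab τ, 𝒟.timeOrientation.IsFutureDirected (mfderiv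 𝓘(ℝ, E4) (𝓡 4) d.flatChart x (E4.basisVector 0))) ∧ (∀ k : ℕ, Filter.Tendsto (fun τ => 𝒟.toSpacetime.deviationCk (Minkowski.backgroundOn d.flatDomain) d.flatChart k τ) Filter.atTop (nhds 0)) ∧ (∀ (i : Fin d.N) (k : ℕ) (ρ : ℝ) (ε : ENNReal), 0 < ε → ∀ᶠ τ in Filter.atTop, ∃ M a : ℝ, m₀ ≤ M ∧ M ≤ m₀⁻¹ ∧ |a| ≤ χ * M ∧ 𝒟.toSpacetime.truncDeviationCk {d.background i with bilin := boostedKerrBilin (d.motion i).1 (d.motion i).2 M a} (d.chart i) k ρ τ ≤ ε ∧ 𝒟.toSpacetime.truncDeviationCk {d.background i with bilin := boostedKerrBilin (d.motion i).1 (d.motion i).2 M a} (d.chart i) k (R i τ) τ ≤ ε)) → (∃ (O' : Set 𝒟.carrier) (d' : FinalStateDecomposition 𝒟.toSpacetime O' 2), (∀ i, Kerr.IsSubextremal (d'.mass i) (d'.spin i)) ∧ O' = Summit.FinalStateConjecture.exteriorOf 𝒟.toCauchyDevelopment d'.charted ∧ Summit.FinalStateConjecture.RaysStayInClosure 𝒟.toCauchyDevelopment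 O' ∧ Summit.FinalStateConjecture.HasExhaustiveCharts d' ∧ Summit.FinalStateConjecture.IsFutureOriented d') := by
  intro X _ _ _ _ _ _ D hD 𝒟 hmax hI hsys
  obtain ⟨m₀, χ, O, d, R, hN0, hbody⟩ := hsys
  refine concl_of_normalisedEra_pointwise X D hD 𝒟 hmax hI ⟨m₀, χ, O, d, R, ?_⟩
  obtain ⟨hm₀, hχ, hO, hrays, hR, hexh, horth, hcov, hflat0, hflat, hW⟩ := hbody
  refine ⟨hm₀, hχ, hO, hrays, hR, hexh, horth, hcov, hflat0, hflat, hW, fun i => ?_⟩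
  exact absurd i.2 (by omega)

end Summit.FinalStateConjecture.FinalStateConjecture.Theorems

end
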